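import Summits.Ventures.PercRepro.S1CoreCapSevenThreeDis

/-!
# PercRepro — `Q*(7) = 19`: THREE BIG LINES NOT IN A PLANE, AND THE INSTANCE (p1, gen 26)

The last case, (A1): two of three big lines meet, `|B ∩ A| = 1`, and the third, `C`, lies in no plane with them
(else `plane_of_three_big` makes the triangle of S1CoreCapSevenThree). The plane on `[B, A]` has `c ≥ 7` points,
`C` meets it in `≤ 1` point and costs `≥ |C| − 2 ≥ 2` after it, so `c + f₀ + |C| + fat (C ∖ P₀) ≤ 12` and the lines
outside `P₁ = C ∪ P₀` (`≤ 1` point on the plane, `≤ 1` on `C`) have free budget `≤ 1`. If there is none, cap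
`≤ |A| + |B| + #chords + f₀ (c − 1)/2 + 5 ≤ 16`; otherwise the budget is exactly one, which forces `c = 7`, `f₀ = 0`,
`|C| = 4` and no new fat point, and by `sdiff_eq_of_free_le_one` every outside line has the same single new point
and one point on `C`: at most `|C| = 4` of them, each of cap `1`, so cap `≤ 8 + 4 + 4 = 16`
(`sum_cap_le_nineteen_of_three_big_meet`). With (A0) (S1CoreCapSevenThreeDis) this is `threeBigNonplanarBound_holds`,
and **`fourCapSpec_seven : FourCapSpec capPaper 7 19`** — the searches' `Q*(7) = 19` is a theorem, every instance
`Q*(1..7) = 1, 4, 5, 8, 11, 16, 19` of the 4-circuit-cap spec is in the kernel. `proofs/P1-S4-CAPBRIDGE.md` §18.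
Axioms: standard.
-/

namespace PercRepro

namespace S1

namespace FourCap

namespace Seven

variable {β : Type} [DecidableEq β]


section ThreeMeet

variable {w : β → ℕ} {ls : Finset (Finset β)}
  (h1 : ∀ L ∈ ls, ∀ v ∈ L, w v = 1 ∨ w v = 2)
  (h2 : ∀ L ∈ ls, 3 ≤ L.card ∧ wsum w L ≤ 5)
  (h3 : ∀ L ∈ ls, ∀ L' ∈ ls, L ≠ L' → (L ∩ L').card ≤ 1)
  (h4 : ∀ l : List (Finset β), l.Nodup → (∀ L ∈ l, L ∈ ls) → wsum w (unionL l) ≤ 7 + lineRank l)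
  (h5 : ∀ l : List (Finset β), l.Nodup → (∀ L ∈ l, L ∈ ls) → lineRank l ≤ 3 → (unionL l).card ≤ 9)
  {A B C : Finset β} (hA : A ∈ ls) (hB : B ∈ ls) (hC : C ∈ ls)
  (hBA : B ≠ A) (hCA : C ≠ A) (hCB : C ≠ B)
  (cA : 4 ≤ A.card) (cB : 4 ≤ B.card) (cC : 4 ≤ C.card)
  (hrest : ∀ L ∈ ls, L ≠ A → L ≠ B → L ≠ C → L.card = 3)
  (hmeet : (B ∩ A).card = 1)
  (hnt : ∀ l : List (Finset β), l.Nodup → (∀ L ∈ l, L ∈ ls) → lineRank l ≤ 3 → A ∈ l → B ∈ l → C ∉ l)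

include h1 h2 h3 h4 h5 hA hB hC hBA hCA hCB cA cB cC hrest hmeet hnt in
/-- **(A1) Two of three big lines meet, the third is in no plane with them: cap sum `≤ 19`** (in fact `≤ 16`). -/
theorem sum_cap_le_nineteen_of_three_big_meet : ∑ L ∈ ls, capPaper L.card (fat w L) ≤ 19 := by
  have h2' := two_le_card_of_spec₇ h2
  obtain ⟨l, hnd, hls, hr, hsub, hmax⟩ := exists_plane ls _ [B, A] le_rfl (by simp [hBA]) (by simp [hA, hB])
    (by rw [lineRank_pair_eq_three (h2' A hA) (h2' B hB) hmeet])
  have hc9 : (unionL l).card ≤ 9 := card_plane_le_nine h5 hnd hls hr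
  have hAl : A ∈ l := hsub A (by simp)
  have hBl : B ∈ l := hsub B (by simp)
  have hCl : C ∉ l := hnt l hnd hls hr hAl hBl
  have hCP : (C ∩ unionL l).card ≤ 1 := hmax C hC hCl
  have hU : A ∪ B ⊆ unionL l := by
    intro v hv
    rcases Finset.mem_union.1 hv with h | h
    · exact mem_unionL_iff.2 ⟨A, hAl, h⟩
    · exact mem_unionL_iff.2 ⟨B, hBl, h⟩
  have hu := Finset.card_union_add_card_inter A B
  rw [Finset.inter_comm] at hu
  have hcU := Finset.card_le_card hU
  have hHc := Finset.card_sdiff_add_card_eq_card hU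
  -- the plane's cost and the third line's
  have hcs := wsum_unionL_eq w l (fun L hL => h1 L (hls L hL)) (fun L hL => h2' L (hls L hL))
  rw [wsum_eq_card_add_fat w (unionL l) (fun v hv => by
    obtain ⟨L, hL, hvL⟩ := mem_unionL_iff.1 hv
    exact h1 L (hls L hL) v hvL)] at hcs
  have hcostC := costSum_le h1 h2' h4 (C :: l) (List.nodup_cons.2 ⟨hCl, hnd⟩) (fun L hL => by
    rcases List.mem_cons.1 hL with rfl | hL
    · exact hC
    · exact hls L hL)
  simp only [costSum] at hcostC
  rw [lineCost_of_inter_le_two (le_trans hCP (by omega))] at hcostC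
  -- the fat points of the plane and its chords
  have hfatin := sum_fat_plane_le₃ w l (fun L hL => (h2 L (hls L hL)).1)
    (fun L hL L' hL' hne => h3 L (hls L hL) L' (hls L' hL') hne)
  set S := (l.toFinset.erase A).erase B with hS
  have hSmem : ∀ X ∈ S, X ∈ l ∧ X ≠ A ∧ X ≠ B := fun X hX => by
    have a := Finset.mem_erase.1 hX; have b := Finset.mem_erase.1 a.2
    exact ⟨List.mem_toFinset.1 b.2, b.1, a.1⟩
  have hSC : ∀ X ∈ S, X ≠ C := fun X hX h => hCl (h ▸ (hSmem X hX).1)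
  have hchords := (card_chords_le (L₁ := A) (L₂ := B) S (fun X hX => by
    obtain ⟨hXl, hX1, hX2⟩ := hSmem X hX
    exact ⟨hrest X (hls X hXl) hX1 hX2 (hSC X hX), fun v hv => mem_unionL_iff.2 ⟨X, hXl, hv⟩,
      h3 X (hls X hXl) A hA hX1, h3 X (hls X hXl) B hB hX2⟩)
    (fun X hX X' hX' hne => h3 X (hls X (hSmem X hX).1) X' (hls X' (hSmem X' hX').1) hne)).1
  -- the lines outside `P₁ = C ∪ P₀`
  set T := (ls.filter (fun L => L ∉ l)).erase C with hT
  have hTmem : ∀ L ∈ T, L ∈ ls ∧ L ∉ l ∧ L ≠ C := fun L hL => by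
    have a := Finset.mem_erase.1 hL; have b := Finset.mem_filter.1 a.2
    exact ⟨b.1, b.2, a.1⟩
  have hT3 : ∀ L ∈ T, L.card = 3 := fun L hL => hrest L (hTmem L hL).1
    (fun h => (hTmem L hL).2.1 (h ▸ hAl)) (fun h => (hTmem L hL).2.1 (h ▸ hBl)) (hTmem L hL).2.2
  have hk : ∀ t : List (Finset β), t.Nodup → (∀ L ∈ t, L ∈ T) →
      freeCountR (C ∪ unionL l) t + fat w (unionLR (C ∪ unionL l) t \ (C ∪ unionL l)) +
        ((unionL l).card + fat w (unionL l) + C.card + fat w (C \ unionL l)) ≤ 12 := by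
    intro t hndt hlt
    have hb := budget_of_prefix h1 h2' h4 (C :: l) t (by
      rw [List.nodup_append']
      refine ⟨hndt, List.nodup_cons.2 ⟨hCl, hnd⟩, fun L hLt hLl => ?_⟩
      rcases List.mem_cons.1 hLl with rfl | hLl
      · exact (hTmem L (hlt L hLt)).2.2 rfl
      · exact (hTmem L (hlt L hLt)).2.1 hLl)
      (fun L hL => by
        rcases List.mem_append.1 hL with hL | hL
        · exact (hTmem L (hlt L hL)).1
        rcases List.mem_cons.1 hL with rfl | hL
        · exact hC
        · exact hls L hL)
      (fun L hL => hT3 L (hlt L hL))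
    simp only [costSum, unionL] at hb
    rw [lineCost_of_inter_le_two (le_trans hCP (by omega))] at hb
    have hsplit := fat_sdiff_add_fat_of_subset w (subset_unionLR (C ∪ unionL l) t)
    have hsplitC : fat w (C \ unionL l) + fat w (unionL l) = fat w (C ∪ unionL l) := by
      have h := fat_sdiff_add_fat_of_subset w (P₀ := unionL l) (U := C ∪ unionL l) Finset.subset_union_right
      rwa [Finset.union_sdiff_right] at h
    omega
  have hwC := wsum_eq_card_add_fat w C (h1 C hC)
  have hC5 := (h2 C hC).2
  have hCsplit := fat_eq_fat_sdiff_add_fat_inter w C (unionL l)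
  have hCinter : fat w (C ∩ unionL l) ≤ fat w (unionL l) := by
    unfold fat; exact Finset.card_le_card (Finset.filter_subset_filter _ Finset.inter_subset_right)
  -- the sum: the plane, `C`, the rest
  have hsplit := Finset.sum_filter_add_sum_filter_not ls (fun L => L ∈ l) (fun L => capPaper L.card (fat w L))
  have hfil : ls.filter (fun L => L ∈ l) = l.toFinset := by
    ext L
    simp only [Finset.mem_filter, List.mem_toFinset]
    exact ⟨fun h => h.2, fun h => ⟨hls L h, h⟩⟩
  rw [hfil] at hsplit
  have hsC := Finset.add_sum_erase (ls.filter (fun L => L ∉ l)) (fun L => capPaper L.card (fat w L))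
    (Finset.mem_filter.2 ⟨hC, hCl⟩)
  rw [← hT] at hsC
  rw [← hsplit, ← hsC, capPaper_big_eq h1 h2 hC cC]
  have hAf : A ∈ l.toFinset := List.mem_toFinset.2 hAl
  have hBf : B ∈ l.toFinset.erase A := Finset.mem_erase.2 ⟨hBA, List.mem_toFinset.2 hBl⟩
  have esum : ∀ f : Finset β → ℕ, ∑ L ∈ l.toFinset, f L = f A + (f B + ∑ X ∈ S, f X) := by
    intro f
    rw [← Finset.add_sum_erase _ f hAf, ← Finset.add_sum_erase _ f hBf]
  have hcap3 : ∀ X ∈ S, capPaper X.card (fat w X) = 1 + fat w X := by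
    intro X hX
    obtain ⟨hXl, hX1, hX2⟩ := hSmem X hX
    have hXls := hls X hXl
    have := wsum_eq_card_add_fat w X (h1 X hXls)
    have := (h2 X hXls).2
    have hXc := hrest X hXls hX1 hX2 (hSC X hX)
    rw [hXc, capPaper_three_eq' (by omega)]
  rw [esum, capPaper_big_eq h1 h2 hA cA, capPaper_big_eq h1 h2 hB cB, Finset.sum_congr rfl hcap3,
    Finset.sum_add_distrib, Finset.sum_const_nat (m := 1) (fun _ _ => rfl), Nat.mul_one]
  rw [esum] at hfatin
  have hwA := wsum_eq_card_add_fat w A (h1 A hA)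
  have hwB := wsum_eq_card_add_fat w B (h1 B hB)
  have hA5 := (h2 A hA).2
  have hB5 := (h2 B hB).2
  -- the rest: empty, or all through one new point with one point on `C`
  have hnc : ∀ X ∈ T, ¬ X ⊆ C ∪ unionL l := by
    intro X hX hsubX
    have hXm := hTmem X hX
    have hcov : X ⊆ (X ∩ C) ∪ (X ∩ unionL l) := by
      intro v hv
      rcases Finset.mem_union.1 (hsubX hv) with h | h
      · exact Finset.mem_union_left _ (Finset.mem_inter.2 ⟨hv, h⟩)
      · exact Finset.mem_union_right _ (Finset.mem_inter.2 ⟨hv, h⟩)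
    have := Finset.card_le_card hcov
    have := Finset.card_union_le (X ∩ C) (X ∩ unionL l)
    have := h3 X hXm.1 C hC hXm.2.2
    have := hmax X hXm.1 hXm.2.1
    have := hT3 X hX
    omega
  have hfree1 : ∀ X ∈ T, freeCountR (C ∪ unionL l) [X] = 1 := fun X hX => by
    simp only [freeCountR, unionLR, hnc X hX, if_false]
  have hsdiff1 : ∀ X ∈ T, unionLR (C ∪ unionL l) [X] \ (C ∪ unionL l) = X \ (C ∪ unionL l) := fun X _ => by
    simp only [unionLR]
    exact Finset.union_sdiff_right (s := X) (t := C ∪ unionL l)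
  have hTcap : ∑ L ∈ T, capPaper L.card (fat w L) ≤ 4 ∧
      (T.Nonempty → (unionL l).card = 7 ∧ fat w (unionL l) = 0 ∧ C.card = 4 ∧ fat w (C \ unionL l) = 0) := by
    rcases Finset.eq_empty_or_nonempty T with hTe | ⟨X₀, hX₀⟩
    · rw [hTe]; simp
    have hX₀free := hk [X₀] (List.nodup_singleton X₀) (by simpa using hX₀)
    rw [hfree1 X₀ hX₀, hsdiff1 X₀ hX₀] at hX₀free
    have hshape : (unionL l).card = 7 ∧ fat w (unionL l) = 0 ∧ C.card = 4 ∧ fat w (C \ unionL l) = 0 := by omega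
    refine ⟨?_, fun _ => hshape⟩
    obtain ⟨hc7, hf0, hC4, hfC0⟩ := hshape
    -- every line of `T` has cap `1`: no fat point on it
    have hfatC : fat w C = 0 := by
      have : fat w (C ∩ unionL l) ≤ fat w (unionL l) := by
        unfold fat; exact Finset.card_le_card (Finset.filter_subset_filter _ Finset.inter_subset_right)
      omega
    have hcap1 : ∀ X ∈ T, capPaper X.card (fat w X) = 1 := by
      intro X hX
      have hXfree := hk [X] (List.nodup_singleton X) (by simpa using hX)
      rw [hfree1 X hX, hsdiff1 X hX] at hXfree
      have e := fat_eq_fat_sdiff_add_fat_inter w X (C ∪ unionL l)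
      have hsub : (X ∩ (C ∪ unionL l)).filter (fun u => w u = 2) ⊆
          C.filter (fun u => w u = 2) ∪ (unionL l).filter (fun u => w u = 2) := by
        intro u hu
        have h' := Finset.mem_filter.1 hu
        rcases Finset.mem_union.1 (Finset.mem_inter.1 h'.1).2 with h | h
        · exact Finset.mem_union_left _ (Finset.mem_filter.2 ⟨h, h'.2⟩)
        · exact Finset.mem_union_right _ (Finset.mem_filter.2 ⟨h, h'.2⟩)
      have hle' : fat w (X ∩ (C ∪ unionL l)) ≤ fat w C + fat w (unionL l) := by
        unfold fat
        exact (Finset.card_le_card hsub).trans (Finset.card_union_le _ _)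
      have hfX : fat w X = 0 := by omega
      rw [hT3 X hX, hfX]
      rfl
    rw [Finset.sum_congr rfl hcap1, Finset.sum_const_nat (m := 1) (fun _ _ => rfl), Nat.mul_one]
    by_cases hT1 : T.card ≤ 1
    · omega
    obtain ⟨X₁, hX₁, hne⟩ : ∃ X₁ ∈ T, X₁ ≠ X₀ := by
      by_contra hc
      push Not at hc
      have : T ⊆ {X₀} := fun X hX => Finset.mem_singleton.2 (hc X hX)
      have := Finset.card_le_card this
      rw [Finset.card_singleton] at this
      omega
    -- two lines of `T` share their unique new point
    have hpair : ∀ X ∈ T, ∀ Y ∈ T, X ≠ Y →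
        X \ (C ∪ unionL l) = Y \ (C ∪ unionL l) ∧ (X \ (C ∪ unionL l)).card = 1 := by
      intro X hX Y hY hXY
      have h2f := hk [Y, X] (by simp [Ne.symm hXY]) (by simp [hX, hY])
      have h2f' := hk [X, Y] (by simp [hXY]) (by simp [hX, hY])
      exact sdiff_eq_of_free_le_one (hnc X hX) (hnc Y hY) (h3 X (hTmem X hX).1 Y (hTmem Y hY).1 hXY)
        (by omega) (by omega)
    have hnew1 : ∀ X ∈ T, (X \ (C ∪ unionL l)).card = 1 := by
      intro X hX
      by_cases hX0 : X = X₀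
      · exact (hpair X hX X₁ hX₁ (hX0 ▸ hne.symm)).2
      · exact (hpair X hX X₀ hX₀ hX0).2
    -- the injection into the points of `C`
    have hmaps : ∀ X ∈ T, X ∩ C ∈ C.powersetCard 1 := by
      intro X hX
      refine Finset.mem_powersetCard.2 ⟨Finset.inter_subset_right, ?_⟩
      have := Finset.card_sdiff_add_card_inter X (C ∪ unionL l)
      have := card_inter_union_le X C (unionL l)
      have := h3 X (hTmem X hX).1 C hC (hTmem X hX).2.2
      have := hmax X (hTmem X hX).1 (hTmem X hX).2.1
      have := hT3 X hX
      have := hnew1 X hX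
      omega
    have hinj : Set.InjOn (fun X : Finset β => X ∩ C) T := by
      intro X hX Y hY hXY
      by_contra hne'
      simp only at hXY
      obtain ⟨hsd, hcard⟩ := hpair X hX Y hY hne'
      obtain ⟨h, hh⟩ := Finset.card_eq_one.1 hcard
      have hhX : h ∈ X \ (C ∪ unionL l) := hh ▸ Finset.mem_singleton_self h
      have hhY : h ∈ Y \ (C ∪ unionL l) := hsd ▸ hhX
      have hy1 : (X ∩ C).card = 1 := (Finset.mem_powersetCard.1 (hmaps X hX)).2
      obtain ⟨y, hy⟩ := Finset.card_eq_one.1 hy1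
      have hyX : y ∈ X ∩ C := hy ▸ Finset.mem_singleton_self y
      have hyY : y ∈ Y ∩ C := hXY ▸ hy ▸ Finset.mem_singleton_self y
      have hhy : h ≠ y := fun e => (Finset.mem_sdiff.1 hhX).2 (Finset.mem_union_left _ (e ▸ (Finset.mem_inter.1 hyX).2))
      have hsub : ({h, y} : Finset β) ⊆ X ∩ Y := by
        intro u hu
        simp only [Finset.mem_insert, Finset.mem_singleton] at hu
        rcases hu with rfl | rfl
        · exact Finset.mem_inter.2 ⟨(Finset.mem_sdiff.1 hhX).1, (Finset.mem_sdiff.1 hhY).1⟩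
        · exact Finset.mem_inter.2 ⟨(Finset.mem_inter.1 hyX).1, (Finset.mem_inter.1 hyY).1⟩
      have := Finset.card_le_card hsub
      rw [Finset.card_pair hhy] at this
      have := h3 X (hTmem X hX).1 Y (hTmem Y hY).1 hne'
      omega
    have := Finset.card_le_card_of_injOn _ hmaps hinj
    rw [Finset.card_powersetCard, Nat.choose_one_right, hC4] at this
    exact this
  obtain ⟨hTle, hTshape⟩ := hTcap
  rcases Finset.eq_empty_or_nonempty T with hTe | hTne
  · rw [hTe] at hTle ⊢
    simp only [Finset.sum_empty] at hTle ⊢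
    -- the table: `c + f₀ + |C| + fat (C ∖ P₀) ≤ 12`, `|A| + |B| − 1 ≤ |A ∪ B| ≤ c`
    have hSb : S.card ≤ (unionL l \ (A ∪ B)).card * (((unionL l).card - 1) / 2) := hchords
    clear hk hfree1 hsdiff1 hnc hTmem hT3 hSmem hSC hsplit hsC esum hcap3 hfil hmax hsub hls hnd hnt
    generalize hc : (unionL l).card = c at hfatin hcs hcostC hc9 hcU hHc hSb
    generalize hf : fat w (unionL l) = f₀ at hfatin hcs hcostC hCinter
    generalize (unionL l \ (A ∪ B)).card = hh at hHc hSb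
    generalize (A ∪ B).card = u at hu hcU hHc
    generalize S.card = s at hSb ⊢
    generalize ∑ X ∈ S, fat w X = d at hfatin ⊢
    generalize fat w A = a at hwA hfatin ⊢
    generalize fat w B = b at hwB hfatin ⊢
    generalize A.card = k1 at cA hwA hu ⊢
    generalize B.card = k2 at cB hwB hu ⊢
    generalize C.card = k3 at cC hwC hcostC ⊢
    generalize fat w (C \ unionL l) = fc at hcostC hCsplit
    generalize fat w C = fC at hwC hCsplit ⊢
    have hk1 : k1 ≤ 5 := by omega
    have hk2 : k2 ≤ 5 := by omega
    have hk3 : k3 ≤ 5 := by omega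
    have hc7 : 7 ≤ c := by omega
    have hc8 : c ≤ 8 := by omega
    have hf2 : f₀ ≤ 1 := by omega
    have hh1 : hh ≤ 1 := by omega
    interval_cases k1 <;> interval_cases k2 <;> interval_cases k3 <;> interval_cases c <;> interval_cases f₀ <;>
      interval_cases hh <;> omega
  · obtain ⟨hc7, hf0, hC4, hfC0⟩ := hTshape hTne
    have hS0 : S.card = 0 := by
      have : (unionL l \ (A ∪ B)).card = 0 := by omega
      rw [this] at hchords
      omega
    rw [hc7, hf0] at hfatin
    rw [hS0]
    have : ∑ X ∈ S, fat w X = 0 := by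
      rw [Finset.card_eq_zero.1 hS0]; simp
    omega

end ThreeMeet

/-! ### The last case, and the instance -/

/-- A triangle has `lineRank [L₃, L₂, L₁] = 3`. -/
theorem lineRank_three_of_triangle {L₁ L₂ L₃ : Finset β} (k1 : 2 ≤ L₁.card) (k2 : 2 ≤ L₂.card) (k3 : 2 ≤ L₃.card)
    (e21 : (L₂ ∩ L₁).card = 1) (e3 : (L₃ ∩ (L₂ ∪ L₁)).card = 2) : lineRank [L₃, L₂, L₁] = 3 := by
  simp only [lineRank, unionL, Finset.union_empty, Finset.sdiff_empty, Finset.inter_empty, Finset.card_empty,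
    Nat.zero_add, e21, e3]
  have := Finset.card_sdiff_add_card_inter L₂ L₁
  have := Finset.card_sdiff_add_card_inter L₃ (L₂ ∪ L₁)
  omega

/-- **OPEN CASE A HOLDS**: three big lines not in a plane give cap sum `≤ 19`. -/
theorem threeBigNonplanarBound_holds : ThreeBigNonplanarBound := by
  intro β _ w ls h1 h2 h3 h4 h5 _ L₁ L₂ L₃ hL₁ hL₂ hL₃ h12 h13 h23 c1 c2 c3 hrest hr
  -- no plane contains the three
  have hnt : ∀ l : List (Finset β), l.Nodup → (∀ L ∈ l, L ∈ ls) → lineRank l ≤ 3 →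
      L₁ ∈ l → L₂ ∈ l → L₃ ∈ l → False := by
    intro l hnd hls hrl hl₁ hl₂ hl₃
    obtain ⟨-, -, -, k2, k3, e21, e3⟩ := plane_of_three_big h3 hL₁ hL₂ hL₃ h12 h13 h23 c1 c2 c3 hl₁ hl₂ hl₃
      (h5 l hnd hls hrl)
    have := lineRank_three_of_triangle (L₁ := L₁) (by omega) (by omega) (by omega) e21 e3
    omega
  have p21 := h3 L₂ hL₂ L₁ hL₁ h12
  have p31 := h3 L₃ hL₃ L₁ hL₁ h13
  have p32 := h3 L₃ hL₃ L₂ hL₂ h23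
  by_cases m21 : (L₂ ∩ L₁).card = 1
  · exact sum_cap_le_nineteen_of_three_big_meet h1 h2 h3 h4 h5 hL₁ hL₂ hL₃ h12 h13 h23 c1 c2 c3 hrest m21
      (fun l hnd hls hrl hl₁ hl₂ hl₃ => hnt l hnd hls hrl hl₁ hl₂ hl₃)
  by_cases m31 : (L₃ ∩ L₁).card = 1
  · exact sum_cap_le_nineteen_of_three_big_meet h1 h2 h3 h4 h5 hL₁ hL₃ hL₂ h13 h12 h23.symm c1 c3 c2
      (fun L hL hA hB hC => hrest L hL hA hC hB) m31
      (fun l hnd hls hrl hl₁ hl₃ hl₂ => hnt l hnd hls hrl hl₁ hl₂ hl₃)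
  by_cases m32 : (L₃ ∩ L₂).card = 1
  · exact sum_cap_le_nineteen_of_three_big_meet h1 h2 h3 h4 h5 hL₂ hL₃ hL₁ h23 h12.symm h13.symm c2 c3 c1
      (fun L hL hA hB hC => hrest L hL hC hA hB) m32
      (fun l hnd hls hrl hl₂ hl₃ hl₁ => hnt l hnd hls hrl hl₁ hl₂ hl₃)
  exact sum_cap_le_nineteen_of_three_disjoint h1 h2 h3 h4 hL₁ hL₂ hL₃ h12 h13 h23 c1 c2 c3 hrest
    (by omega) (by omega) (by omega)

/-- **THE INSTANCE `ν = 7`, PROVED**: `FourCapSpec capPaper 7 19` — the searches' `Q*(7) = 19` is a theorem. -/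
theorem fourCapSpec_seven : FourCapSpec capPaper 7 19 :=
  fourCapSpec_seven_of_threeBig threeBigNonplanarBound_holds

end Seven

end FourCap

end S1

end PercRepro
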